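import Summits.AnomalousDissipation.AnomalousDissipation.Theorems.TaylorGreenLoudGalerkinStates.Negative.LoadBearing
import Summits.AnomalousDissipation.AnomalousDissipation.Theorems.LaminarNeverLoud.Negative.StokesArc
import Literature.Analysis.FluidPDE.CheskidovAssemblyTools
import Literature.Analysis.FunctionSpaces.TorusEnstrophyOrthogonality
import Literature.Analysis.FunctionSpaces.TorusLerayHelmholtzProofs

/-!
# Disproof of `GalerkinSteadyZerothLaw` — standing adversary's work file (findings: NO KILL; see index)

Crux `stmt-AnomalousDissipation-2986` =
`Summit.AnomalousDissipation.AnomalousDissipation.Theses.MirrorVariety.GalerkinSteadyZerothLaw` (route `MirrorVariety`,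
rank 0, the route's Thesis X): SOME smooth divergence-free mean-zero force `f` on `T³`, SOME `ν_j → 0⁺`, `E`, `ε > 0` such
that for every `j` and INFINITELY MANY resolutions `N` there is a smooth div-free mean-zero Fourier–Galerkin steady state `U`,
band-limited to `0 < |k|² ≤ N²`, solving the tested Galerkin equations `∫⟪U,(U·∇)a⟫ + ν_j⟪U,Δa⟫ + ⟪f,a⟫ = 0`, with
`∫|U|² ≤ E` and `ν_j‖∇U‖² ≥ ε`.

## Index of findings (refuter-cdisprove-stmt-AnomalousDissipation-2986-0, cycle 1, 2026-08-16)

* §0 `crux_iff` — the crux is `∃ f, IsSmooth f ∧ IsDivFree f ∧ HasZeroMean f ∧ LoudWitness f` with the vocabulary below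
  (`SteadyState` is dimension-generic and agrees `Iff.rfl` with the landed `Negative.IsSteadyState` of crux 2987 on `T³`).
  RELATIONS: the crux is implied by the sibling crux `TaylorGreenLoudGalerkinStates` (one force, `∀ᶠ N`) — it is the
  WEAKEST loudness statement of the route; its negation (`not_crux_iff`) is a laminarisation theorem for EVERY force.
* §1 DECORATION: `0 < ν j` carries no load (`loudWitness_iff_noPos`: loudness `ε ≤ ν_j‖∇U‖²`, `ε > 0` force `ν_j > 0`).
* §2 WITNESS ANATOMY for a general force (what every proof must respect; all sorry-free):
  `energy_identity` (`ν‖∇U‖² = ∫⟪f,U⟫`, any `d`), `loudness_le` (`ν‖∇U‖² ≤ ‖f‖₂‖U‖₂`), hence the refuted strengthenings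
  `not_loud_of_small_energy` (`E·∫‖f‖² < ε²` is impossible: the only scale-free budget is `β = ε²/(E∫‖f‖²) ≤ 1`),
  `not_loudWitness_zero_force`, `not_loud_frequently_uniform_resolution` (with the landed general-force Bernstein floor
  `ε ≤ 4π²ν_jN²E` of crux 2987: the `∃ᶠ N` live on the diagonal `N ≳ (ε/4π²ν_jE)^{1/2} → ∞`; not even a sparse `j`-uniform
  set of resolutions exists), and the cited landed `not_loud_with_one_state` (the state depends on `j`).
* §2b SCALE COVARIANCE: `steadyState_smul` (`(U,ν,f) ↦ (tU,tν,t²f)`), `frequentlyLoud_smul` (`(E,ε) ↦ (t²E,t³ε)`), `loudWitness_smul`,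
  `crux_iff_normalised` (WLOG `∫‖f‖² = 1`: only the shape of `f` and the scale-free budget `ε²/(E∫‖f‖²)` matter).
* §3 LOAD-BEARING OBLIGATIONS (for an `∃`-statement: which conjuncts of the conclusion cannot be dropped without
  trivialising it), all witnessed by the explicit STOKES STATES of the shear force `2a cos(2πm x₁)e₀` turned into
  tested-form fields by the coefficient→field bridge `steadyState_fieldOf`:
  WITHOUT the energy bound the crux is TRUE (`crux_true_without_energy_bound`), WITHOUT `ν_j → 0` it is TRUE
  (`crux_true_without_vanishing_viscosity`), with a `j`-DEPENDENT energy bound it is TRUE (`crux_true_with_moving_energy`);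
  and the ceiling of §2 is TIGHT at every single viscosity (`loudness_eq_on_stokesField`: `ν‖∇U‖² = ‖f‖₂‖U‖₂`).
  So the whole content is: bounded energy AND loudness AND `ν → 0` simultaneously — uniformly in nothing else.
* §4 ENSTROPHY BALANCE in tested form, any dimension (`enstrophy_balance`: `ν∫|ΔU|² = ∫⟪(U·∇)U,ΔU⟫ − ∫⟪Δf,U⟫`) and the
  STRETCHING FLOOR (`stretching_floor`: loud bounded states have enstrophy production `≥ ε²/(νE) − ‖Δf‖₂√E → ∞` like `ν⁻¹`).
  DIMENSION IS LOAD-BEARING: the verbatim two-dimensional transcription `GalerkinSteadyZerothLaw2D` is FALSE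
  (`not_galerkinSteadyZerothLaw2D`): on `T²` every tested-form steady Galerkin state obeys the steady Alexakis–Doering
  bound `(ν‖∇U‖²)² ≤ ν ‖Δf‖₂ (∫|U|²)^{3/2}` (`planar_loudness_sq_le`, enstrophy balance with vanishing stretching,
  FMRT (A.62)), so `ν_j‖∇U‖² → 0` at bounded energy for EVERY force. Any proof of the crux must use vortex stretching.
* §5 `not_crux_iff` — the exact shape of a kill: for every smooth solenoidal mean-free `f`, every `ν_j → 0⁺`, all
  `E, ε > 0`, some `j` such that EVENTUALLY IN `N` every bounded admissible state is quiet. Open in 3-D (no laminarisation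
  theorem for steady states; the planar one is §4); no finite computation refutes an `∃ f ∃ ν ∃ E ε ∀ j ∃ᶠ N` statement.
* §6 (docblock at the end) Why it resists, what is pinned down, next attacks.

House rules: prose only in docstrings/comments; `sorry` only in the `NearMisses` section (none at present).
-/

noncomputable section

set_option linter.dupNamespace false

open scoped InnerProductSpace Topology ComplexConjugate
open MeasureTheory Filter UnitAddTorus
open Literature.Analysis.FunctionSpaces Literature.Analysis.FunctionSpaces.Torus
open Literature.Analysis.FluidPDE

namespace Summit.AnomalousDissipation.AnomalousDissipation.Cruxes.GalerkinSteadyZerothLaw.Disproof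

open Summit.AnomalousDissipation.AnomalousDissipation.Theses.MirrorVariety (GalerkinSteadyZerothLaw)
open Summit.AnomalousDissipation.AnomalousDissipation.Theorems.TaylorGreenLoudGalerkinStates.Negative
  (IsBandLimited IsSteadyState resolution_floor not_loud_at_fixed_resolution not_loud_uniformly_in_resolution
    gradNormSq_le_of_isBandLimited isDivFree_zero not_loud_with_one_state)

variable {d : Type*} [Fintype d] [DecidableEq d]

/-! ## §0 Vocabulary (transparent, dimension-generic restatements of the crux's clauses) -/

/-- Band-limitation to the punctured frequency ball `0 < |k|² ≤ N²` (verbatim the crux's clause, any dimension). -/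
def BandLimited (N : ℕ) (U : UnitAddTorus d → EuclideanSpace ℝ d) : Prop :=
  ∀ k ∉ (freqBall N).erase (0 : d → ℤ), mFourierCoeff (EuclideanSpace.complexify ∘ U) k = 0

/-- Admissible Galerkin steady state at `(ν, N)` for the force `f` — verbatim the bracket of the crux (any dimension):
smooth, div-free, mean-zero, band-limited, and the tested Galerkin equations against every band-limited smooth div-free
test. -/
def SteadyState (ν : ℝ) (N : ℕ) (f U : UnitAddTorus d → EuclideanSpace ℝ d) : Prop :=
  IsSmooth U ∧ IsDivFree U ∧ HasZeroMean U ∧ BandLimited N U ∧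
    ∀ a : UnitAddTorus d → EuclideanSpace ℝ d, IsSmooth a → IsDivFree a → BandLimited N a →
      ∫ x, (⟪U x, convect U a x⟫_ℝ + ν * ⟪U x, laplacian a x⟫_ℝ + ⟪f x, a x⟫_ℝ) = 0

/-- The crux's matrix for a force `f`, a viscosity sequence and budgets: for every `j`, FREQUENTLY in `N`, a loud
bounded admissible state. -/
def FrequentlyLoud (f : UnitAddTorus d → EuclideanSpace ℝ d) (ν : ℕ → ℝ) (E ε : ℝ) : Prop :=
  ∀ j, ∃ᶠ N in atTop, ∃ U : UnitAddTorus d → EuclideanSpace ℝ d,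
    SteadyState (ν j) N f U ∧ ∫ x, ‖U x‖ ^ 2 ≤ E ∧ ε ≤ ν j * gradNormSq U

/-- The crux's conclusion for a force `f`: some positive `ν_j → 0`, some `E`, some `ε > 0` with `FrequentlyLoud`. -/
def LoudWitness (f : UnitAddTorus d → EuclideanSpace ℝ d) : Prop :=
  ∃ (ν : ℕ → ℝ) (E ε : ℝ), (∀ j, 0 < ν j) ∧ Tendsto ν atTop (𝓝 0) ∧ 0 < ε ∧ FrequentlyLoud f ν E ε

/-- On `T³` the generic bracket is, definitionally, the landed `Negative.IsSteadyState` of crux 2987. [folklore] -/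
theorem steadyState_iff (ν : ℝ) (N : ℕ) (f U : UnitAddTorus (Fin 3) → EuclideanSpace ℝ (Fin 3)) :
    SteadyState ν N f U ↔ IsSteadyState ν N f U := Iff.rfl

/-- **The crux, unfolded**: `GalerkinSteadyZerothLaw ↔ ∃ f smooth solenoidal mean-free, LoudWitness f`. [folklore] -/
theorem crux_iff :
    GalerkinSteadyZerothLaw ↔ ∃ f : UnitAddTorus (Fin 3) → EuclideanSpace ℝ (Fin 3),
      IsSmooth f ∧ IsDivFree f ∧ HasZeroMean f ∧ LoudWitness f := Iff.rfl

/-! ## §1 A hypothesis that carries no load: `0 < ν j` -/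

/-- Loudness at a positive level forces positive viscosity (`gradNormSq ≥ 0`). [folklore] -/
theorem pos_of_loud {ν ε : ℝ} {U : UnitAddTorus d → EuclideanSpace ℝ d} (hε : 0 < ε) (h : ε ≤ ν * gradNormSq U) :
    0 < ν := by
  by_contra hν
  have : ν * gradNormSq U ≤ 0 := mul_nonpos_of_nonpos_of_nonneg (not_lt.1 hν) (gradNormSq_nonneg U)
  linarith

/-- **`∀ j, 0 < ν j` is decoration**: it follows from `0 < ε` and the loudness clause (a loud state exists for every `j`
since `atTop` on `ℕ` is non-trivial). Information for the prover: positivity of the viscosities is never the issue. [folklore] -/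
theorem loudWitness_iff_noPos (f : UnitAddTorus d → EuclideanSpace ℝ d) :
    LoudWitness f ↔ ∃ (ν : ℕ → ℝ) (E ε : ℝ), Tendsto ν atTop (𝓝 0) ∧ 0 < ε ∧ FrequentlyLoud f ν E ε := by
  constructor
  · rintro ⟨ν, E, ε, -, hlim, hε, h⟩
    exact ⟨ν, E, ε, hlim, hε, h⟩
  · rintro ⟨ν, E, ε, hlim, hε, h⟩
    refine ⟨ν, E, ε, fun j => ?_, hlim, hε, h⟩
    obtain ⟨N, U, -, -, hloud⟩ := (h j).exists
    exact pos_of_loud hε hloud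

/-! ## §2 Witness anatomy for a general force -/

/-- **Energy (injection) identity**, any dimension: every admissible state at `(ν, N)` for a continuous force satisfies
`ν ‖∇U‖² = ∫ ⟪f, U⟫` (test with `a := U`; antisymmetry of the trilinear form + Green; Temam 1979 Ch. II (1.29)). [folklore] -/
theorem energy_identity {ν : ℝ} {N : ℕ} {f U : UnitAddTorus d → EuclideanSpace ℝ d}
    (hU : SteadyState ν N f U) (hf : Continuous f) :
    ν * gradNormSq U = ∫ x, ⟪f x, U x⟫_ℝ := by
  obtain ⟨hs, hdiv, -, hband, htest⟩ := hU
  have h := htest U hs hdiv hband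
  have h1 : ∫ x, ⟪U x, convect U U x⟫_ℝ = 0 := by
    have ha := integral_inner_convect_eq_neg hs hdiv hs hs
    have hc : ∫ x, ⟪convect U U x, U x⟫_ℝ = ∫ x, ⟪U x, convect U U x⟫_ℝ :=
      integral_congr_ae (ae_of_all _ fun x => real_inner_comm _ _)
    linarith
  have h2 : ∫ x, ⟪U x, laplacian U x⟫_ℝ = -gradNormSq U := by
    have hint : ∀ i, Integrable (fun x => ‖partialDeriv i U x‖ ^ 2) volume := fun i =>
      ((hs.partialDeriv i).continuous.norm.pow 2).integrable_unitAddTorus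
    rw [integral_inner_laplacian_eq_neg_holds hs, gradNormSq, integral_finsetSum _ fun i _ => hint i]
  have i1 : Integrable (fun x => ⟪U x, convect U U x⟫_ℝ) volume := (hs.inner (hs.convect hs)).integrable
  have i2 : Integrable (fun x => ν * ⟪U x, laplacian U x⟫_ℝ) volume :=
    (hs.inner hs.laplacian).integrable.const_mul ν
  have i3 : Integrable (fun x => ⟪f x, U x⟫_ℝ) volume :=
    (hf.inner hs.continuous).integrable_unitAddTorus
  have i12 : Integrable (fun x => ⟪U x, convect U U x⟫_ℝ + ν * ⟪U x, laplacian U x⟫_ℝ) volume := i1.add i2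
  rw [integral_add i12 i3, integral_add i1 i2, integral_const_mul, h1, h2] at h
  linarith

/-- **Injection ceiling for a general force**: `ν‖∇U‖² = ∫⟪f,U⟫ ≤ ‖f‖₂ ‖U‖₂` (Cauchy–Schwarz). [folklore] -/
theorem loudness_le {ν : ℝ} {N : ℕ} {f U : UnitAddTorus d → EuclideanSpace ℝ d}
    (hU : SteadyState ν N f U) (hf : Continuous f) :
    ν * gradNormSq U ≤ Real.sqrt (∫ x, ‖f x‖ ^ 2) * Real.sqrt (∫ x, ‖U x‖ ^ 2) := by
  rw [energy_identity hU hf]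
  have hfm : MemLp f 2 volume := hf.memLp_of_hasCompactSupport (HasCompactSupport.of_compactSpace _)
  have hUm : MemLp U 2 volume := hU.1.continuous.memLp_of_hasCompactSupport (HasCompactSupport.of_compactSpace _)
  exact (le_abs_self _).trans (abs_integral_inner_le_sqrt_mul_sqrt hfm hUm)

/-- **Budget window**: a loud bounded admissible state forces `ε² ≤ (∫‖f‖²) · E`. [folklore] -/
theorem sq_le_of_loud {ν E ε : ℝ} {N : ℕ} {f U : UnitAddTorus d → EuclideanSpace ℝ d}
    (hU : SteadyState ν N f U) (hf : Continuous f) (hε : 0 ≤ ε) (hE : ∫ x, ‖U x‖ ^ 2 ≤ E)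
    (hloud : ε ≤ ν * gradNormSq U) : ε ^ 2 ≤ (∫ x, ‖f x‖ ^ 2) * E := by
  have hF0 : 0 ≤ ∫ x, ‖f x‖ ^ 2 := integral_nonneg fun _ => sq_nonneg _
  have hU0 : 0 ≤ ∫ x, ‖U x‖ ^ 2 := integral_nonneg fun _ => sq_nonneg _
  have h1 := hloud.trans (loudness_le hU hf)
  have h2 : ε ^ 2 ≤ (Real.sqrt (∫ x, ‖f x‖ ^ 2) * Real.sqrt (∫ x, ‖U x‖ ^ 2)) ^ 2 := pow_le_pow_left₀ hε h1 2
  rw [mul_pow, Real.sq_sqrt hF0, Real.sq_sqrt hU0] at h2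
  exact h2.trans (mul_le_mul_of_nonneg_left hE hF0)

/-- **Natural strengthening refuted: budgets below the injection window.** For EVERY continuous force there is no loud
witness with `E · ∫‖f‖² < ε²`; the only scale-free budget of the crux is `β = ε²/(E∫‖f‖²) ∈ (0, 1]`. [folklore] -/
theorem not_loud_of_small_energy {f : UnitAddTorus d → EuclideanSpace ℝ d} (hf : Continuous f) :
    ¬ ∃ (ν : ℕ → ℝ) (E ε : ℝ), 0 < ε ∧ E * ∫ x, ‖f x‖ ^ 2 < ε ^ 2 ∧ FrequentlyLoud f ν E ε := by
  rintro ⟨ν, E, ε, hε, hE, h⟩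
  obtain ⟨N, U, hU, hUE, hloud⟩ := (h 0).exists
  have := sq_le_of_loud hU hf hε.le hUE hloud
  nlinarith

/-- **The zero force has no loud witness** (loudness = injection = 0): a proof must use `f ≠ 0` quantitatively, through
`loudness_le`. [folklore] -/
theorem not_loudWitness_zero_force : ¬ LoudWitness (fun _ : UnitAddTorus d => (0 : EuclideanSpace ℝ d)) := by
  rintro ⟨ν, E, ε, -, -, hε, h⟩
  obtain ⟨N, U, hU, -, hloud⟩ := (h 0).exists
  have hid := energy_identity hU continuous_const
  simp only [inner_zero_left, integral_zero] at hid
  linarith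

/-! ### Resolution (cited, not re-proved)

The landed `TaylorGreenLoudGalerkinStates.Negative.resolution_floor` (`ε ≤ 4π²νN²E`, Bernstein), `not_loud_at_fixed_resolution f`
(no single resolution serves all `j`) and `not_loud_uniformly_in_resolution f` (the swap `∀ᶠ N, ∀ j` is false), all general-force
on `T³` (`Theorems/TaylorGreenLoudGalerkinStates/Negative/LoadBearing.lean`), apply to `SteadyState` verbatim (`steadyState_iff` is
`Iff.rfl`), as does `not_loud_with_one_state` (the state depends on `j`). Only the `∃ᶠ` sharpening below is new. -/

/-- **Natural strengthening refuted: a `j`-uniform set of resolutions, even a sparse one** (EVERY force). The crux's `∀ j, ∃ᶠ N`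
cannot be strengthened to `∃ᶠ N, ∀ j` (sharpening the landed `not_loud_uniformly_in_resolution`, which refutes `∀ᶠ N, ∀ j`): a
single resolution would serve all `j`, against the resolution floor `ε ≤ 4π²ν_jN²E → 0`. The frequently-many `N` of the crux
necessarily drift to infinity with `j` (`N_j ≥ (ε/4π²Eν_j)^{1/2}`). [folklore] -/
theorem not_loud_frequently_uniform_resolution (f : UnitAddTorus (Fin 3) → EuclideanSpace ℝ (Fin 3)) :
    ¬ ∃ (ν : ℕ → ℝ) (E ε : ℝ), (∀ j, 0 < ν j) ∧ Tendsto ν atTop (𝓝 0) ∧ 0 < ε ∧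
        ∃ᶠ N in atTop, ∀ j, ∃ U : UnitAddTorus (Fin 3) → EuclideanSpace ℝ (Fin 3),
          SteadyState (ν j) N f U ∧ ∫ x, ‖U x‖ ^ 2 ≤ E ∧ ε ≤ ν j * gradNormSq U := by
  rintro ⟨ν, E, ε, hν, hlim, hε, h⟩
  obtain ⟨N, hN⟩ := h.exists
  exact not_loud_at_fixed_resolution f ⟨ν, E, ε, N, hν, hlim, hε, hN⟩

/-! ### §2b Scale covariance (Grashof normalisation): `(U, ν, f, E, ε) ↦ (tU, tν, t²f, t²E, t³ε)`

The tested form is homogeneous: `U ↦ tU`, `ν ↦ tν`, `f ↦ t²f` multiplies the integrand by `t²`; energy scales by `t²`, loudness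
`ν‖∇U‖²` by `t³`. So witnesses come in scaling orbits, the force may be normalised (`∫‖f‖² = 1`, `crux_iff_normalised`), and the
only scale-free budget is `β = ε²/(E∫‖f‖²) ∈ (0, 1]` (§2). Rescaling alone never produces a witness: it moves `ν_j` too. -/

/-- Scalar multiples of smooth divergence-free fields are divergence free. [folklore] -/
theorem isDivFree_const_smul {U : UnitAddTorus d → EuclideanSpace ℝ d} (hU : IsSmooth U) (hdiv : IsDivFree U) (t : ℝ) :
    IsDivFree (t • U) := by
  intro x
  have h := hdiv x
  simp only [divergence] at h ⊢
  have hcomp : ∀ i, (fun y => (t • U) y i) = t • fun y => U y i := fun i => by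
    funext y; simp [Pi.smul_apply, smul_eq_mul]
  simp_rw [hcomp, partialDeriv_const_smul ((hU.apply _).isContDiff (by simp)) t, Pi.smul_apply, smul_eq_mul,
    ← Finset.mul_sum, h, mul_zero]

omit [DecidableEq d] in
/-- `((tU)·∇)a = t (U·∇)a` (the convective derivative is linear in the advecting field). [folklore] -/
theorem convect_smul_left (t : ℝ) (U : UnitAddTorus d → EuclideanSpace ℝ d) (a : UnitAddTorus d → EuclideanSpace ℝ d)
    (x : UnitAddTorus d) : convect (t • U) a x = t • convect U a x := by
  show Torus.fderiv a x ((t • U) x) = t • Torus.fderiv a x (U x)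
  rw [Pi.smul_apply, map_smul]

omit [DecidableEq d] in
/-- Complexification commutes with real scalar multiplication of fields. [folklore] -/
theorem complexify_comp_smul (t : ℝ) (U : UnitAddTorus d → EuclideanSpace ℝ d) :
    EuclideanSpace.complexify ∘ (t • U) = (t : ℂ) • (EuclideanSpace.complexify ∘ U) := by
  funext x
  simp only [Function.comp_apply, Pi.smul_apply, map_smul]
  exact (RCLike.real_smul_eq_coe_smul (K := ℂ) t _)

/-- Band-limitation is preserved by scalar multiplication. [folklore] -/
theorem bandLimited_smul {N : ℕ} {U : UnitAddTorus d → EuclideanSpace ℝ d} (hband : BandLimited N U) (t : ℝ) :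
    BandLimited N (t • U) := by
  intro k hk
  rw [complexify_comp_smul, mFourierCoeff_const_smul, hband k hk, smul_zero]

/-- **Homogeneity of the tested steady form**: if `U` is an admissible steady state at `(ν, N)` for `f`, then `tU` is one at
`(tν, N)` for `t²f`. [folklore] -/
theorem steadyState_smul {ν : ℝ} {N : ℕ} {f U : UnitAddTorus d → EuclideanSpace ℝ d} (hU : SteadyState ν N f U) (t : ℝ) :
    SteadyState (t * ν) N ((t ^ 2) • f) (t • U) := by
  obtain ⟨hs, hdiv, hmean, hband, htest⟩ := hU
  refine ⟨hs.smul t, isDivFree_const_smul hs hdiv t, ?_, bandLimited_smul hband t, ?_⟩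
  · show ∫ x, (t • U) x = 0
    have hm : ∫ x, U x = 0 := hmean
    simp_rw [Pi.smul_apply]
    rw [integral_smul, hm, smul_zero]
  · intro a ha hdiva hbanda
    have h := htest a ha hdiva hbanda
    have hpt : (fun x => ⟪(t • U) x, convect (t • U) a x⟫_ℝ + t * ν * ⟪(t • U) x, laplacian a x⟫_ℝ +
        ⟪((t ^ 2) • f) x, a x⟫_ℝ) =
        fun x => t ^ 2 * (⟪U x, convect U a x⟫_ℝ + ν * ⟪U x, laplacian a x⟫_ℝ + ⟪f x, a x⟫_ℝ) := by
      funext x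
      rw [convect_smul_left]
      simp only [Pi.smul_apply, real_inner_smul_left, real_inner_smul_right]
      ring
    rw [hpt, integral_const_mul, h, mul_zero]

omit [DecidableEq d] in
/-- Energy scales by `t²`. [folklore] -/
theorem integral_norm_sq_smul (t : ℝ) (U : UnitAddTorus d → EuclideanSpace ℝ d) :
    ∫ x, ‖(t • U) x‖ ^ 2 = t ^ 2 * ∫ x, ‖U x‖ ^ 2 := by
  simp_rw [Pi.smul_apply, norm_smul, mul_pow, Real.norm_eq_abs, sq_abs]
  exact integral_const_mul _ _

/-- `‖∇(tU)‖² = t²‖∇U‖²` for smooth `U`. [folklore] -/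
theorem gradNormSq_smul {U : UnitAddTorus d → EuclideanSpace ℝ d} (hU : IsSmooth U) (t : ℝ) :
    gradNormSq (t • U) = t ^ 2 * gradNormSq U := by
  unfold gradNormSq
  simp_rw [partialDeriv_const_smul (hU.isContDiff (by simp)) t, Pi.smul_apply, norm_smul, mul_pow, Real.norm_eq_abs,
    sq_abs, ← Finset.mul_sum]
  exact integral_const_mul _ _

/-- **Scaling orbit of a witness**: `FrequentlyLoud f ν E ε → FrequentlyLoud (t²f) (tν) (t²E) (t³ε)` for `t > 0`. [folklore] -/
theorem frequentlyLoud_smul {f : UnitAddTorus d → EuclideanSpace ℝ d} {ν : ℕ → ℝ} {E ε : ℝ}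
    (h : FrequentlyLoud f ν E ε) {t : ℝ} (ht : 0 < t) :
    FrequentlyLoud ((t ^ 2) • f) (fun j => t * ν j) (t ^ 2 * E) (t ^ 3 * ε) := by
  intro j
  refine (h j).mono fun N => ?_
  rintro ⟨U, hU, hE, hloud⟩
  refine ⟨t • U, steadyState_smul hU t, ?_, ?_⟩
  · rw [integral_norm_sq_smul]
    exact mul_le_mul_of_nonneg_left hE (sq_nonneg t)
  · rw [gradNormSq_smul hU.1 t]
    have ht3 : 0 ≤ t ^ 3 := by positivity
    calc t ^ 3 * ε ≤ t ^ 3 * (ν j * gradNormSq U) := mul_le_mul_of_nonneg_left hloud ht3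
      _ = t * ν j * (t ^ 2 * gradNormSq U) := by ring

/-- The loud-witness property is invariant under positive rescaling of the force. [folklore] -/
theorem loudWitness_smul {f : UnitAddTorus d → EuclideanSpace ℝ d} (h : LoudWitness f) {t : ℝ} (ht : 0 < t) :
    LoudWitness ((t ^ 2) • f) := by
  obtain ⟨ν, E, ε, hν, hlim, hε, hL⟩ := h
  refine ⟨fun j => t * ν j, t ^ 2 * E, t ^ 3 * ε, fun j => mul_pos ht (hν j), ?_, by positivity, frequentlyLoud_smul hL ht⟩
  simpa using hlim.const_mul t

/-- A force with a loud witness has positive `L²` mass (by the budget window `ε² ≤ E∫‖f‖²`). [folklore] -/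
theorem integral_norm_sq_pos_of_loudWitness {f : UnitAddTorus d → EuclideanSpace ℝ d} (hf : Continuous f)
    (h : LoudWitness f) : 0 < ∫ x, ‖f x‖ ^ 2 := by
  obtain ⟨ν, E, ε, -, -, hε, hL⟩ := h
  obtain ⟨N, U, hU, hUE, hloud⟩ := (hL 0).exists
  have hw := sq_le_of_loud hU hf hε.le hUE hloud
  by_contra hF
  have hF0 : ∫ x, ‖f x‖ ^ 2 = 0 := le_antisymm (not_lt.1 hF) (integral_nonneg fun _ => sq_nonneg _)
  rw [hF0, zero_mul] at hw
  nlinarith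

/-- **Normalisation**: the crux is equivalent to its version with a UNIT force `∫‖f‖² = 1` (rescale by `t = (∫‖f‖²)^{-1/4}`).
Information for the prover: the amplitude of the force is immaterial; only the scale-free budget `ε²/(E∫‖f‖²)` and the SHAPE
of `f` matter. [folklore] -/
theorem crux_iff_normalised :
    GalerkinSteadyZerothLaw ↔ ∃ f : UnitAddTorus (Fin 3) → EuclideanSpace ℝ (Fin 3),
      IsSmooth f ∧ IsDivFree f ∧ HasZeroMean f ∧ ∫ x, ‖f x‖ ^ 2 = 1 ∧ LoudWitness f := by
  rw [crux_iff]
  constructor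
  · rintro ⟨f, hf, hdiv, hmean, hW⟩
    set F : ℝ := ∫ x, ‖f x‖ ^ 2 with hFdef
    have hF : 0 < F := integral_norm_sq_pos_of_loudWitness hf.continuous hW
    set t : ℝ := 1 / Real.sqrt (Real.sqrt F) with htdef
    have hsF : 0 < Real.sqrt F := Real.sqrt_pos.2 hF
    have ht : 0 < t := by positivity
    have ht2 : t ^ 2 = 1 / Real.sqrt F := by
      rw [htdef, div_pow, one_pow, Real.sq_sqrt hsF.le]
    have ht4 : t ^ 4 * F = 1 := by
      have : t ^ 4 = (t ^ 2) ^ 2 := by ring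
      rw [this, ht2, div_pow, one_pow, Real.sq_sqrt hF.le, one_div, inv_mul_cancel₀ hF.ne']
    refine ⟨(t ^ 2) • f, hf.smul _, isDivFree_const_smul hf hdiv _, ?_, ?_, loudWitness_smul hW ht⟩
    · show ∫ x, ((t ^ 2) • f) x = 0
      have hm : ∫ x, f x = 0 := hmean
      simp_rw [Pi.smul_apply]
      rw [integral_smul, hm, smul_zero]
    · rw [integral_norm_sq_smul, ← hFdef, ← ht4]
      ring
  · rintro ⟨f, hf, hdiv, hmean, -, hW⟩
    exact ⟨f, hf, hdiv, hmean, hW⟩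

/-! ## §3 Load-bearing obligations, witnessed by the Stokes states of a shear force

For an `∃`-statement the load-bearing analysis asks which CONJUNCTS OF THE CONCLUSION cannot be deleted without making the
statement trivially true. The witnesses are the explicit laminar Stokes states `U = f/(4π²νm²)` of the shear force
`f = 2a cos(2π m x₁) e₀` (landed at the coefficient level in `Theorems/LaminarNeverLoud/Negative/StokesArc.lean`), turned into
tested-form fields by the coefficient → field bridge below (the converse bookkeeping of `exists_steady_galerkin_approx`). -/

open Summit.AnomalousDissipation.AnomalousDissipation.Theorems.LaminarNeverLoud.Negative

/-- The real field of a coefficient vector on the punctured ball of radius `N`. -/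
def fieldOf (N : ℕ) (c : ↥(modes d N) → EuclideanSpace ℂ d) : UnitAddTorus d → EuclideanSpace ℝ d :=
  realTrigPoly (modes d N) (coeffExt (modes d N) c)

/-- **Coefficient → field bridge.** Every zero `c ∈ galerkinSubspace S_N` of the stationary Galerkin field
`galerkinRHS S_N ν ĝ` driven by the Fourier vector `ĝ` of an `L²` force `f` yields an admissible tested-form steady state
`fieldOf N c` of the crux at `(ν, N)` for the force `f` (verbatim the last clause of `exists_steady_galerkin_approx`, run on a
GIVEN zero instead of the Brouwer one). This is how coefficient-level witnesses (continuation numerics, explicit arcs) enter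
the crux. [folklore] -/
theorem steadyState_fieldOf {ν : ℝ} {N : ℕ} {f : UnitAddTorus d → EuclideanSpace ℝ d} (hf : MemLp f 2 volume)
    {c : ↥(modes d N) → EuclideanSpace ℂ d} (hc : c ∈ galerkinSubspace (modes d N))
    (h0 : galerkinRHS (modes d N) ν (forceCoeff (modes d N) f) c = 0) :
    SteadyState ν N f (fieldOf N c) := by
  have hS : ∀ k ∈ modes d N, -k ∈ modes d N := modes_symm N
  have hS0 : (0 : d → ℤ) ∉ modes d N := zero_not_mem_modes N
  have hfi : Integrable f volume := hf.integrable one_le_two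
  have hgr : IsRealCoeff (forceCoeff (modes d N) f) := isRealCoeff_forceCoeff (modes d N) hfi
  have hCsymm : IsConjSymm (coeffExt (modes d N) c) := hc.1.isConjSymm_coeffExt hS
  have hCT : IsTransversal (modes d N) (coeffExt (modes d N) c) := hc.2.isTransversal_coeffExt
  have hGg : realTrigPoly (modes d N) (coeffExt (modes d N) (forceCoeff (modes d N) f)) =
      realTrigPoly (modes d N) fun k => mFourierCoeff (EuclideanSpace.complexify ∘ f) k :=
    realTrigPoly_coeffExt_restrict _
  refine ⟨isSmooth_realTrigPoly _ _, isDivFree_realTrigPoly hCT, hasZeroMean_realTrigPoly_of_zero_not_mem hS0 _,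
    fun k hk => mFourierCoeff_realTrigPoly_eq_zero hS hCsymm hk, ?_⟩
  intro a ha hdiv hband
  have hid := Literature.Analysis.FluidPDE.Torus.sum_re_inner_galerkinField_test ν hS (hgr.isConjSymm_coeffExt hS) hCsymm hCT ha hdiv hband
  have hzero : ∑ k ∈ modes d N, (inner ℂ (Literature.Analysis.FluidPDE.Torus.galerkinField ν (modes d N) (coeffExt (modes d N) (forceCoeff (modes d N) f))
      (coeffExt (modes d N) c) k) (mFourierCoeff (EuclideanSpace.complexify ∘ a) k)).re = 0 := by
    refine Finset.sum_eq_zero fun k hk => ?_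
    have hk0 : Literature.Analysis.FluidPDE.Torus.galerkinField ν (modes d N) (coeffExt (modes d N) (forceCoeff (modes d N) f))
        (coeffExt (modes d N) c) k = 0 := by
      have := congrFun h0 ⟨k, hk⟩
      rwa [galerkinRHS_apply] at this
    rw [hk0, inner_zero_left, Complex.zero_re]
  rw [hzero, hGg] at hid
  have hu : IsSmooth (fieldOf N c) := isSmooth_realTrigPoly _ _
  have hGs : IsSmooth (realTrigPoly (modes d N) fun k => mFourierCoeff (EuclideanSpace.complexify ∘ f) k) :=
    isSmooth_realTrigPoly _ _
  have i1 : Integrable (fun x => ⟪fieldOf N c x, convect (fieldOf N c) a x⟫_ℝ +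
      ν * ⟪fieldOf N c x, laplacian a x⟫_ℝ) volume :=
    ((hu.continuous.inner (hu.convect ha).continuous).add
      ((hu.continuous.inner ha.laplacian.continuous).const_smul ν)).integrable_unitAddTorus
  have i2 : Integrable (fun x => ⟪realTrigPoly (modes d N)
      (fun k => mFourierCoeff (EuclideanSpace.complexify ∘ f) k) x, a x⟫_ℝ) volume :=
    (hGs.continuous.inner ha.continuous).integrable_unitAddTorus
  have i3 : Integrable (fun x => ⟪f x, a x⟫_ℝ) volume := integrable_inner_of_continuous hfi ha.continuous
  have hforce := integral_inner_realTrigPoly_mFourierCoeff_eq hS hf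
    (ha.continuous.memLp_of_hasCompactSupport (HasCompactSupport.of_compactSpace _)) hband
  unfold fieldOf at i1 ⊢
  rw [integral_add i1 i2, hforce, ← integral_add i1 i3] at hid
  exact hid.symm

/-- Parseval: the energy of `fieldOf N c` is the coefficient energy `∑‖c k‖²`. [folklore] -/
theorem integral_norm_sq_fieldOf {N : ℕ} {c : ↥(modes d N) → EuclideanSpace ℂ d}
    (hc : c ∈ galerkinSubspace (modes d N)) : ∫ x, ‖fieldOf N c x‖ ^ 2 = energy c := by
  rw [fieldOf, integral_norm_sq_realTrigPoly (modes_symm N) (hc.1.isConjSymm_coeffExt (modes_symm N)),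
    sum_coeffExt (fun _ v => ‖v‖ ^ 2) c]
  rfl

/-- Parseval: `ν‖∇(fieldOf N c)‖²` is the coefficient dissipation `ν·4π²∑|k|²‖c k‖²`. [folklore] -/
theorem loudness_fieldOf {N : ℕ} (ν : ℝ) {c : ↥(modes d N) → EuclideanSpace ℂ d}
    (hc : c ∈ galerkinSubspace (modes d N)) : ν * gradNormSq (fieldOf N c) = dissipation ν c := by
  rw [fieldOf, gradNormSq_eq_toReal_eGradNormSq_holds (isSmooth_realTrigPoly _ _),
    toReal_eGradNormSq_realTrigPoly (modes_symm N) (hc.1.isConjSymm_coeffExt (modes_symm N)),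
    sum_coeffExt (fun k v => freqNormSq k * ‖v‖ ^ 2) c]
  rfl

/-- The Stokes state of the shear force `2a cos(2π m x₁) e₀` at viscosity `ν`, as a field band-limited to resolution `N`
(`= 2(a/(4π²νm²)) cos(2π m x₁) e₀` when `N ≥ |m|`). -/
def stokesField (m : ℤ) (a ν : ℝ) (N : ℕ) : UnitAddTorus (Fin 3) → EuclideanSpace ℝ (Fin 3) :=
  fieldOf N (shearVec (modes (Fin 3) N) m (a / (4 * Real.pi ^ 2 * ν * (m : ℝ) ^ 2)))

variable {m : ℤ}

/-- **The Stokes states are admissible steady states of the crux** (tested form), at every resolution `N ≥ |m|` and every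
`ν ≠ 0`. [folklore] -/
theorem steadyState_stokesField (hm : m ≠ 0) (a : ℝ) {ν : ℝ} (hν : ν ≠ 0) {N : ℕ} (hN : m.natAbs ≤ N) :
    SteadyState ν N (shearForce m a) (stokesField m a ν N) := by
  have h0 := galerkinRHS_stokesPoint (kol_mem_modes hm hN) (neg_kol_mem_modes hm hN) hm a hν
  rw [← forceCoeff_shearForce] at h0
  exact steadyState_fieldOf ((isSmooth_shearForce m a).memLp 2) (shearVec_mem m _) h0

/-- Energy of the Stokes state: `∫|U|² = 2(a/(4π²νm²))²`. [folklore] -/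
theorem integral_norm_sq_stokesField (hm : m ≠ 0) (a ν : ℝ) {N : ℕ} (hN : m.natAbs ≤ N) :
    ∫ x, ‖stokesField m a ν N x‖ ^ 2 = 2 * (a / (4 * Real.pi ^ 2 * ν * (m : ℝ) ^ 2)) ^ 2 := by
  rw [stokesField, integral_norm_sq_fieldOf (shearVec_mem m _)]
  exact energy_stokesPoint (kol_mem_modes hm hN) (neg_kol_mem_modes hm hN) hm a ν

/-- Loudness of the Stokes state: `ν‖∇U‖² = a²/(2π²νm²)`. [folklore] -/
theorem loudness_stokesField (hm : m ≠ 0) (a : ℝ) {ν : ℝ} (hν : ν ≠ 0) {N : ℕ} (hN : m.natAbs ≤ N) :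
    ν * gradNormSq (stokesField m a ν N) = a ^ 2 / (2 * Real.pi ^ 2 * ν * (m : ℝ) ^ 2) := by
  rw [stokesField, loudness_fieldOf ν (shearVec_mem m _)]
  exact dissipation_stokesPoint_eq (kol_mem_modes hm hN) (neg_kol_mem_modes hm hN) hm a hν

/-- `∫‖2a cos(2π m x₁)e₀‖² = 2a²`. [folklore] -/
theorem integral_norm_sq_shearForce (hm : m ≠ 0) (a : ℝ) : ∫ x, ‖shearForce m a x‖ ^ 2 = 2 * a ^ 2 := by
  rw [shearForce, integral_norm_sq_realTrigPoly (shearModes_symm m) (isConjSymm_shearCoeff m a), shearModes,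
    Finset.sum_pair (kol_ne_neg hm), shearCoeff_of_shear a (Or.inl rfl), shearCoeff_of_shear a (Or.inr rfl),
    norm_smul_e0_sq]
  ring

/-- **TIGHTNESS of the injection ceiling `loudness_le`**: on the Stokes state, `ν‖∇U‖² = ‖f‖₂‖U‖₂` (equality in
Cauchy–Schwarz: `U ∥ f`). So at each SINGLE viscosity the budget window `ε² ≤ E∫‖f‖²` of §2 cannot be improved; what the
Stokes states cannot do is keep `E` bounded as `ν → 0` (`integral_norm_sq_stokesField ∼ ν⁻²`). [folklore] -/
theorem loudness_eq_on_stokesField (hm : m ≠ 0) (a : ℝ) {ν : ℝ} (hν : 0 < ν) {N : ℕ} (hN : m.natAbs ≤ N) :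
    ν * gradNormSq (stokesField m a ν N) =
      Real.sqrt (∫ x, ‖shearForce m a x‖ ^ 2) * Real.sqrt (∫ x, ‖stokesField m a ν N x‖ ^ 2) := by
  have hm' : (m : ℝ) ≠ 0 := Int.cast_ne_zero.2 hm
  rw [loudness_stokesField hm a hν.ne' hN, integral_norm_sq_shearForce hm a, integral_norm_sq_stokesField hm a ν hN,
    ← Real.sqrt_mul (by positivity)]
  symm
  rw [Real.sqrt_eq_iff_mul_self_eq (by positivity) (by positivity)]
  field_simp
  ring

/-- The gravest shear force `2cos(2πx₁)e₀` is an admissible force of the crux. [folklore] -/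
theorem shearForce_admissible : IsSmooth (shearForce 1 1) ∧ IsDivFree (shearForce 1 1) ∧ HasZeroMean (shearForce 1 1) :=
  ⟨isSmooth_shearForce 1 1, isDivFree_shearForce 1 1, hasZeroMean_shearForce one_ne_zero 1⟩

/-- Loudness of the gravest Stokes state in closed form: `ν‖∇U‖² = 1/(2π²ν)`. [folklore] -/
theorem loudness_stokesField_one {ν : ℝ} (hν : ν ≠ 0) {N : ℕ} (hN : 1 ≤ N) :
    ν * gradNormSq (stokesField 1 1 ν N) = 1 / (2 * Real.pi ^ 2 * ν) := by
  rw [loudness_stokesField one_ne_zero 1 hν hN]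
  push_cast
  ring

/-- Energy of the gravest Stokes state in closed form: `∫|U|² = 2/(4π²ν)²`. [folklore] -/
theorem integral_norm_sq_stokesField_one (ν : ℝ) {N : ℕ} (hN : 1 ≤ N) :
    ∫ x, ‖stokesField 1 1 ν N x‖ ^ 2 = 2 * (1 / (4 * Real.pi ^ 2 * ν)) ^ 2 := by
  rw [integral_norm_sq_stokesField one_ne_zero 1 ν hN]
  push_cast
  ring

/-- **THE ENERGY BOUND IS LOAD-BEARING**: with the clause `∫|U|² ≤ E` deleted the crux is TRUE — the Stokes states of the
gravest shear force along `ν_j = 1/(j+1)` are loud (`ν_j‖∇U‖² = (j+1)/(2π²) ≥ 1/(2π²)`) at every resolution `N ≥ 1`, while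
their energy `2(j+1)²/(16π⁴)` runs away. (The laminar runaway of the route's card, as a theorem about the statement.)
[folklore] -/
theorem crux_true_without_energy_bound :
    ∃ f : UnitAddTorus (Fin 3) → EuclideanSpace ℝ (Fin 3), IsSmooth f ∧ IsDivFree f ∧ HasZeroMean f ∧
      ∃ (ν : ℕ → ℝ) (ε : ℝ), (∀ j, 0 < ν j) ∧ Tendsto ν atTop (𝓝 0) ∧ 0 < ε ∧
        ∀ j, ∃ᶠ N in atTop, ∃ U : UnitAddTorus (Fin 3) → EuclideanSpace ℝ (Fin 3),
          SteadyState (ν j) N f U ∧ ε ≤ ν j * gradNormSq U := by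
  refine ⟨shearForce 1 1, shearForce_admissible.1, shearForce_admissible.2.1, shearForce_admissible.2.2,
    fun j => 1 / ((j : ℝ) + 1), 1 / (2 * Real.pi ^ 2), fun j => by positivity,
    tendsto_one_div_add_atTop_nhds_zero_nat, by positivity, fun j => ?_⟩
  refine Filter.Eventually.frequently ((eventually_ge_atTop 1).mono fun N hN => ?_)
  have hν : 1 / ((j : ℝ) + 1) ≠ 0 := by positivity
  refine ⟨stokesField 1 1 (1 / ((j : ℝ) + 1)) N, steadyState_stokesField one_ne_zero 1 hν hN, ?_⟩
  rw [loudness_stokesField_one hν hN]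
  have hj : (0 : ℝ) ≤ j := Nat.cast_nonneg j
  have hπ : 0 < 2 * Real.pi ^ 2 := by positivity
  have h1 : 1 / ((j : ℝ) + 1) ≤ 1 := by rw [div_le_one (by positivity)]; linarith
  rw [div_le_div_iff₀ hπ (by positivity), one_mul, one_mul]
  exact mul_le_of_le_one_right hπ.le h1

/-- **`ν_j → 0` IS LOAD-BEARING**: with `Tendsto ν atTop (𝓝 0)` deleted the crux is TRUE — constant viscosity `ν_j = 1` and
the gravest Stokes state, loud `1/(2π²)` and bounded `2/(16π⁴)`, at every resolution `N ≥ 1`. [folklore] -/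
theorem crux_true_without_vanishing_viscosity :
    ∃ f : UnitAddTorus (Fin 3) → EuclideanSpace ℝ (Fin 3), IsSmooth f ∧ IsDivFree f ∧ HasZeroMean f ∧
      ∃ (ν : ℕ → ℝ) (E ε : ℝ), (∀ j, 0 < ν j) ∧ 0 < ε ∧ FrequentlyLoud f ν E ε := by
  refine ⟨shearForce 1 1, shearForce_admissible.1, shearForce_admissible.2.1, shearForce_admissible.2.2,
    fun _ => 1, 2 * (1 / (4 * Real.pi ^ 2 * 1)) ^ 2, 1 / (2 * Real.pi ^ 2 * 1), fun _ => one_pos, by positivity,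
    fun j => ?_⟩
  refine Filter.Eventually.frequently ((eventually_ge_atTop 1).mono fun N hN => ?_)
  exact ⟨stokesField 1 1 1 N, steadyState_stokesField one_ne_zero 1 one_ne_zero hN,
    (integral_norm_sq_stokesField_one 1 hN).le, (loudness_stokesField_one one_ne_zero hN).ge⟩

/-- **UNIFORMITY OF `E` IN `j` IS LOAD-BEARING**: with a `j`-dependent energy budget (`∀ j, ∃ E, …`) the crux is TRUE
along `ν_j = 1/(j+1) → 0` — the gravest Stokes states again, `E_j = 2((j+1)/(4π²))²`. [folklore] -/
theorem crux_true_with_moving_energy :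
    ∃ f : UnitAddTorus (Fin 3) → EuclideanSpace ℝ (Fin 3), IsSmooth f ∧ IsDivFree f ∧ HasZeroMean f ∧
      ∃ (ν : ℕ → ℝ) (ε : ℝ), (∀ j, 0 < ν j) ∧ Tendsto ν atTop (𝓝 0) ∧ 0 < ε ∧
        ∀ j, ∃ E : ℝ, ∃ᶠ N in atTop, ∃ U : UnitAddTorus (Fin 3) → EuclideanSpace ℝ (Fin 3),
          SteadyState (ν j) N f U ∧ ∫ x, ‖U x‖ ^ 2 ≤ E ∧ ε ≤ ν j * gradNormSq U := by
  refine ⟨shearForce 1 1, shearForce_admissible.1, shearForce_admissible.2.1, shearForce_admissible.2.2,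
    fun j => 1 / ((j : ℝ) + 1), 1 / (2 * Real.pi ^ 2), fun j => by positivity,
    tendsto_one_div_add_atTop_nhds_zero_nat, by positivity, fun j => ⟨2 * (1 / (4 * Real.pi ^ 2 * (1 / ((j : ℝ) + 1)))) ^ 2, ?_⟩⟩
  refine Filter.Eventually.frequently ((eventually_ge_atTop 1).mono fun N hN => ?_)
  have hν : 1 / ((j : ℝ) + 1) ≠ 0 := by positivity
  refine ⟨stokesField 1 1 (1 / ((j : ℝ) + 1)) N, steadyState_stokesField one_ne_zero 1 hν hN,
    (integral_norm_sq_stokesField_one _ hN).le, ?_⟩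
  rw [loudness_stokesField_one hν hN]
  have hj : (0 : ℝ) ≤ j := Nat.cast_nonneg j
  have hπ : 0 < 2 * Real.pi ^ 2 := by positivity
  have h1 : 1 / ((j : ℝ) + 1) ≤ 1 := by rw [div_le_one (by positivity)]; linarith
  rw [div_le_div_iff₀ hπ (by positivity), one_mul, one_mul]
  exact mul_le_of_le_one_right hπ.le h1

/-! ## §4 Dimension is load-bearing: the two-dimensional transcription of the crux is FALSE

On `T²` the enstrophy balance of a steady state has no stretching term (FMRT 2001 App. II.A (A.62), tree
`integral_inner_laplacian_convect_self_eq_zero`): testing the Galerkin equations with `a := ΔU` (admissible: smooth, div-free,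
band-limited) gives `ν∫|ΔU|² = −∫⟪Δf, U⟫ ≤ ‖Δf‖₂‖U‖₂`, and with `‖∇U‖⁴ ≤ ‖U‖²∫|ΔU|²` the steady Alexakis–Doering bound
`(ν‖∇U‖²)² ≤ ν‖Δf‖₂‖U‖₂³` follows at EVERY tested-form steady Galerkin state of EVERY resolution, for EVERY smooth force.
Hence the verbatim planar crux fails: bounded states are uniformly quiet as `ν_j → 0`. -/

/-- The Laplacian of a smooth divergence-free field on `T^d` is divergence free (Fourier side: `𝓕(ΔU)(k) = −4π²|k|²Û(k)` is
transversal when `Û(k)` is). [folklore] -/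
theorem isDivFree_laplacian {U : UnitAddTorus d → EuclideanSpace ℝ d} (hU : IsSmooth U) (hdiv : IsDivFree U) :
    IsDivFree (laplacian U) := by
  refine isDivFree_of_sum_mul_mFourierCoeff_eq_zero hU.laplacian fun k => ?_
  have h := hdiv.sum_mul_mFourierCoeff_eq_zero hU k
  simp_rw [mFourierCoeff_complexify_laplacian hU k, PiLp.neg_apply, PiLp.smul_apply, smul_eq_mul]
  calc ∑ j, (k j : ℂ) * -((((4 * Real.pi ^ 2 * freqNormSq k : ℝ) : ℂ)) *
          mFourierCoeff (EuclideanSpace.complexify ∘ U) k j)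
      = -((((4 * Real.pi ^ 2 * freqNormSq k : ℝ) : ℂ)) *
          ∑ j, (k j : ℂ) * mFourierCoeff (EuclideanSpace.complexify ∘ U) k j) := by
        rw [Finset.mul_sum, ← Finset.sum_neg_distrib]
        exact Finset.sum_congr rfl fun j _ => by ring
    _ = 0 := by rw [h, mul_zero, neg_zero]

/-- The Laplacian of a band-limited smooth field is band-limited to the same ball. [folklore] -/
theorem bandLimited_laplacian {N : ℕ} {U : UnitAddTorus d → EuclideanSpace ℝ d} (hU : IsSmooth U)
    (hband : BandLimited N U) : BandLimited N (laplacian U) := by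
  intro k hk
  rw [mFourierCoeff_complexify_laplacian hU k, hband k hk, smul_zero, neg_zero]

/-- Green: `‖∇U‖² = −∫⟪U, ΔU⟫` for smooth `U`. [folklore] -/
theorem gradNormSq_eq_neg_integral {U : UnitAddTorus d → EuclideanSpace ℝ d} (hU : IsSmooth U) :
    gradNormSq U = -∫ x, ⟪U x, laplacian U x⟫_ℝ := by
  have hint : ∀ i, Integrable (fun x => ‖partialDeriv i U x‖ ^ 2) volume := fun i =>
    ((hU.partialDeriv i).continuous.norm.pow 2).integrable_unitAddTorus
  rw [integral_inner_laplacian_eq_neg_holds hU, gradNormSq, integral_finsetSum _ fun i _ => hint i, neg_neg]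

/-- Interpolation `‖∇U‖⁴ ≤ ‖U‖₂² ∫|ΔU|²` for smooth `U` (Green + Cauchy–Schwarz). [cite: AlexakisDoering2006PLA, §2] -/
theorem gradNormSq_sq_le {U : UnitAddTorus d → EuclideanSpace ℝ d} (hU : IsSmooth U) :
    gradNormSq U ^ 2 ≤ (∫ x, ‖U x‖ ^ 2) * ∫ x, ‖laplacian U x‖ ^ 2 := by
  have hcs : |∫ x, ⟪U x, laplacian U x⟫_ℝ| ≤
      Real.sqrt (∫ x, ‖U x‖ ^ 2) * Real.sqrt (∫ x, ‖laplacian U x‖ ^ 2) :=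
    abs_integral_inner_le_sqrt_mul_sqrt (hU.memLp 2) (hU.laplacian.memLp 2)
  have h0 : 0 ≤ ∫ x, ‖U x‖ ^ 2 := integral_nonneg fun _ => sq_nonneg _
  have h1 : 0 ≤ ∫ x, ‖laplacian U x‖ ^ 2 := integral_nonneg fun _ => sq_nonneg _
  calc gradNormSq U ^ 2 = |∫ x, ⟪U x, laplacian U x⟫_ℝ| ^ 2 := by rw [gradNormSq_eq_neg_integral hU, ← sq_abs, abs_neg]
    _ ≤ (Real.sqrt (∫ x, ‖U x‖ ^ 2) * Real.sqrt (∫ x, ‖laplacian U x‖ ^ 2)) ^ 2 :=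
        pow_le_pow_left₀ (abs_nonneg _) hcs 2
    _ = (∫ x, ‖U x‖ ^ 2) * ∫ x, ‖laplacian U x‖ ^ 2 := by rw [mul_pow, Real.sq_sqrt h0, Real.sq_sqrt h1]

/-- **Enstrophy balance at a tested-form steady Galerkin state (any dimension)**: testing with `a := ΔU` (admissible),
`ν ∫|ΔU|² = ∫⟪(U·∇)U, ΔU⟫ − ∫⟪Δf, U⟫` — palinstrophy dissipation = enstrophy production by stretching + enstrophy injection
(FMRT 2001 App. II.A (A.55) in tested form). [cite: FoiasManleyRosaTemam2001, App. II.A (A.55)] -/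
theorem enstrophy_balance {ν : ℝ} {N : ℕ} {f U : UnitAddTorus d → EuclideanSpace ℝ d}
    (hU : SteadyState ν N f U) (hf : IsSmooth f) :
    ν * ∫ x, ‖laplacian U x‖ ^ 2 = (∫ x, ⟪convect U U x, laplacian U x⟫_ℝ) - ∫ x, ⟪laplacian f x, U x⟫_ℝ := by
  obtain ⟨hs, hdiv, -, hband, htest⟩ := hU
  have h := htest (laplacian U) hs.laplacian (isDivFree_laplacian hs hdiv) (bandLimited_laplacian hs hband)
  have h1 : ∫ x, ⟪U x, convect U (laplacian U) x⟫_ℝ = -∫ x, ⟪convect U U x, laplacian U x⟫_ℝ := by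
    have ha := integral_inner_convect_eq_neg hs hdiv hs hs.laplacian
    linarith
  have h2 : ∫ x, ⟪U x, laplacian (laplacian U) x⟫_ℝ = ∫ x, ‖laplacian U x‖ ^ 2 := by
    calc ∫ x, ⟪U x, laplacian (laplacian U) x⟫_ℝ = ∫ x, ⟪laplacian (laplacian U) x, U x⟫_ℝ :=
          integral_congr_ae (ae_of_all _ fun x => real_inner_comm _ _)
      _ = ∫ x, ⟪laplacian U x, laplacian U x⟫_ℝ := integral_inner_laplacian_comm hs.laplacian hs
      _ = ∫ x, ‖laplacian U x‖ ^ 2 := integral_congr_ae (ae_of_all _ fun x => real_inner_self_eq_norm_sq _)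
  have h3 : ∫ x, ⟪f x, laplacian U x⟫_ℝ = ∫ x, ⟪laplacian f x, U x⟫_ℝ := (integral_inner_laplacian_comm hf hs).symm
  have i1 : Integrable (fun x => ⟪U x, convect U (laplacian U) x⟫_ℝ) volume := (hs.inner (hs.convect hs.laplacian)).integrable
  have i2 : Integrable (fun x => ν * ⟪U x, laplacian (laplacian U) x⟫_ℝ) volume :=
    (hs.inner hs.laplacian.laplacian).integrable.const_mul ν
  have i3 : Integrable (fun x => ⟪f x, laplacian U x⟫_ℝ) volume := (hf.inner hs.laplacian).integrable
  have i12 : Integrable (fun x => ⟪U x, convect U (laplacian U) x⟫_ℝ + ν * ⟪U x, laplacian (laplacian U) x⟫_ℝ) volume :=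
    i1.add i2
  rw [integral_add i12 i3, integral_add i1 i2, integral_const_mul, h1, h2, h3] at h
  linarith

/-- **THE STRETCHING FLOOR (witness anatomy in every dimension).** A loud bounded admissible state of a smooth force at
`(ν, N)`, `ν ≥ 0`, produces enstrophy at the rate `∫⟪(U·∇)U, ΔU⟫ ≥ ε²/(νE) − ‖Δf‖₂√E`:
`ε² ≤ ν E (∫⟪(U·∇)U, ΔU⟫ + ‖Δf‖₂ √E)` (from `(ν‖∇U‖²)² ≤ ν‖U‖² · ν∫|ΔU|²` and the enstrophy balance). Along a witness sequence
of the crux the enstrophy production by vortex stretching must therefore DIVERGE like `ν_j⁻¹`, uniformly over the resolutions used;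
a refutation may assume it, a proof must produce it. In two dimensions the production vanishes identically and the crux fails
(`not_galerkinSteadyZerothLaw2D`). [folklore] -/
theorem stretching_floor {ν E ε : ℝ} (hν : 0 ≤ ν) {N : ℕ} {f U : UnitAddTorus d → EuclideanSpace ℝ d}
    (hU : SteadyState ν N f U) (hf : IsSmooth f) (hE : ∫ x, ‖U x‖ ^ 2 ≤ E) (hε : 0 ≤ ε)
    (hloud : ε ≤ ν * gradNormSq U) :
    ε ^ 2 ≤ ν * E * ((∫ x, ⟪convect U U x, laplacian U x⟫_ℝ) +
      Real.sqrt (∫ x, ‖laplacian f x‖ ^ 2) * Real.sqrt E) := by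
  have hs : IsSmooth U := hU.1
  set P : ℝ := ∫ x, ⟪convect U U x, laplacian U x⟫_ℝ with hP
  set W : ℝ := ∫ x, ‖U x‖ ^ 2 with hW
  set L : ℝ := ∫ x, ‖laplacian f x‖ ^ 2 with hL
  have hW0 : 0 ≤ W := integral_nonneg fun _ => sq_nonneg _
  have hE0 : 0 ≤ E := hW0.trans hE
  have hbal := enstrophy_balance hU hf
  have hcs : |∫ x, ⟪laplacian f x, U x⟫_ℝ| ≤ Real.sqrt L * Real.sqrt W :=
    abs_integral_inner_le_sqrt_mul_sqrt (hf.laplacian.memLp 2) (hs.memLp 2)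
  have hpal0 : 0 ≤ ν * ∫ x, ‖laplacian U x‖ ^ 2 := mul_nonneg hν (integral_nonneg fun _ => sq_nonneg _)
  -- `ν ∫|ΔU|² = P − ∫⟪Δf,U⟫ ≤ P + √L √W`, and both are `≥ 0`
  have hνL : ν * ∫ x, ‖laplacian U x‖ ^ 2 ≤ P + Real.sqrt L * Real.sqrt W := by
    rw [hbal]
    have := neg_abs_le (∫ x, ⟪laplacian f x, U x⟫_ℝ)
    linarith
  have hPW0 : 0 ≤ P + Real.sqrt L * Real.sqrt W := hpal0.trans hνL
  have hmonoW : P + Real.sqrt L * Real.sqrt W ≤ P + Real.sqrt L * Real.sqrt E := by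
    have := mul_le_mul_of_nonneg_left (Real.sqrt_le_sqrt hE) (Real.sqrt_nonneg L)
    linarith
  have hint := gradNormSq_sq_le hs
  have h1 : ε ^ 2 ≤ (ν * gradNormSq U) ^ 2 := pow_le_pow_left₀ hε hloud 2
  calc ε ^ 2 ≤ (ν * gradNormSq U) ^ 2 := h1
    _ = ν ^ 2 * gradNormSq U ^ 2 := by ring
    _ ≤ ν ^ 2 * (W * ∫ x, ‖laplacian U x‖ ^ 2) := mul_le_mul_of_nonneg_left hint (sq_nonneg ν)
    _ = ν * W * (ν * ∫ x, ‖laplacian U x‖ ^ 2) := by ring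
    _ ≤ ν * W * (P + Real.sqrt L * Real.sqrt W) := mul_le_mul_of_nonneg_left hνL (mul_nonneg hν hW0)
    _ ≤ ν * E * (P + Real.sqrt L * Real.sqrt E) :=
        mul_le_mul (mul_le_mul_of_nonneg_left hE hν) hmonoW hPW0 (mul_nonneg hν hE0)

/-- **Planar enstrophy balance at a tested-form steady Galerkin state**: on `T²`, `ν ∫|ΔU|² = −∫⟪Δf, U⟫` (test with
`a := ΔU`; the trilinear term `∫⟪U,(U·∇)ΔU⟫ = −∫⟪ΔU,(U·∇)U⟫` vanishes in two dimensions). [cite: FoiasManleyRosaTemam2001, App. II.A (A.62)] -/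
theorem planar_enstrophy_balance {ν : ℝ} {N : ℕ} {f U : UnitAddTorus (Fin 2) → EuclideanSpace ℝ (Fin 2)}
    (hU : SteadyState ν N f U) (hf : IsSmooth f) :
    ν * ∫ x, ‖laplacian U x‖ ^ 2 = -∫ x, ⟪laplacian f x, U x⟫_ℝ := by
  obtain ⟨hs, hdiv, -, hband, htest⟩ := hU
  have h := htest (laplacian U) hs.laplacian (isDivFree_laplacian hs hdiv) (bandLimited_laplacian hs hband)
  have h1 : ∫ x, ⟪U x, convect U (laplacian U) x⟫_ℝ = 0 := by
    have ha := integral_inner_convect_eq_neg hs hdiv hs hs.laplacian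
    have h2d := integral_inner_laplacian_convect_self_eq_zero hs hdiv
    have hc : ∫ x, ⟪convect U U x, laplacian U x⟫_ℝ = ∫ x, ⟪laplacian U x, convect U U x⟫_ℝ :=
      integral_congr_ae (ae_of_all _ fun x => real_inner_comm _ _)
    linarith
  have h2 : ∫ x, ⟪U x, laplacian (laplacian U) x⟫_ℝ = ∫ x, ‖laplacian U x‖ ^ 2 := by
    calc ∫ x, ⟪U x, laplacian (laplacian U) x⟫_ℝ = ∫ x, ⟪laplacian (laplacian U) x, U x⟫_ℝ :=
          integral_congr_ae (ae_of_all _ fun x => real_inner_comm _ _)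
      _ = ∫ x, ⟪laplacian U x, laplacian U x⟫_ℝ := integral_inner_laplacian_comm hs.laplacian hs
      _ = ∫ x, ‖laplacian U x‖ ^ 2 := integral_congr_ae (ae_of_all _ fun x => real_inner_self_eq_norm_sq _)
  have h3 : ∫ x, ⟪f x, laplacian U x⟫_ℝ = ∫ x, ⟪laplacian f x, U x⟫_ℝ := (integral_inner_laplacian_comm hf hs).symm
  have i1 : Integrable (fun x => ⟪U x, convect U (laplacian U) x⟫_ℝ) volume := (hs.inner (hs.convect hs.laplacian)).integrable
  have i2 : Integrable (fun x => ν * ⟪U x, laplacian (laplacian U) x⟫_ℝ) volume :=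
    (hs.inner hs.laplacian.laplacian).integrable.const_mul ν
  have i3 : Integrable (fun x => ⟪f x, laplacian U x⟫_ℝ) volume := (hf.inner hs.laplacian).integrable
  have i12 : Integrable (fun x => ⟪U x, convect U (laplacian U) x⟫_ℝ + ν * ⟪U x, laplacian (laplacian U) x⟫_ℝ) volume :=
    i1.add i2
  rw [integral_add i12 i3, integral_add i1 i2, integral_const_mul, h1, h2, h3] at h
  linarith

/-- **The steady Alexakis–Doering bound at the Galerkin level (tested form)**: on `T²`, for `ν ≥ 0`, every admissible
steady Galerkin state of a smooth force obeys `(ν‖∇U‖²)² ≤ ν ‖U‖₂² (‖Δf‖₂ ‖U‖₂)`, uniformly in the resolution.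
[cite: AlexakisDoering2006PLA] -/
theorem planar_loudness_sq_le {ν : ℝ} (hν : 0 ≤ ν) {N : ℕ} {f U : UnitAddTorus (Fin 2) → EuclideanSpace ℝ (Fin 2)}
    (hU : SteadyState ν N f U) (hf : IsSmooth f) :
    (ν * gradNormSq U) ^ 2 ≤
      ν * (∫ x, ‖U x‖ ^ 2) * (Real.sqrt (∫ x, ‖laplacian f x‖ ^ 2) * Real.sqrt (∫ x, ‖U x‖ ^ 2)) := by
  have hs : IsSmooth U := hU.1
  have hZ := planar_enstrophy_balance hU hf
  have hcs : |∫ x, ⟪laplacian f x, U x⟫_ℝ| ≤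
      Real.sqrt (∫ x, ‖laplacian f x‖ ^ 2) * Real.sqrt (∫ x, ‖U x‖ ^ 2) :=
    abs_integral_inner_le_sqrt_mul_sqrt (hf.laplacian.memLp 2) (hs.memLp 2)
  have hνL : ν * ∫ x, ‖laplacian U x‖ ^ 2 ≤ Real.sqrt (∫ x, ‖laplacian f x‖ ^ 2) * Real.sqrt (∫ x, ‖U x‖ ^ 2) := by
    rw [hZ]
    exact (neg_le_abs _).trans hcs
  have hint := gradNormSq_sq_le hs
  have h0 : 0 ≤ ∫ x, ‖U x‖ ^ 2 := integral_nonneg fun _ => sq_nonneg _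
  calc (ν * gradNormSq U) ^ 2 = ν ^ 2 * gradNormSq U ^ 2 := by ring
    _ ≤ ν ^ 2 * ((∫ x, ‖U x‖ ^ 2) * ∫ x, ‖laplacian U x‖ ^ 2) := mul_le_mul_of_nonneg_left hint (sq_nonneg ν)
    _ = ν * (∫ x, ‖U x‖ ^ 2) * (ν * ∫ x, ‖laplacian U x‖ ^ 2) := by ring
    _ ≤ ν * (∫ x, ‖U x‖ ^ 2) * (Real.sqrt (∫ x, ‖laplacian f x‖ ^ 2) * Real.sqrt (∫ x, ‖U x‖ ^ 2)) :=
        mul_le_mul_of_nonneg_left hνL (mul_nonneg hν h0)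

/-- **Planar laminarisation of bounded steady Galerkin states, uniformly in `N`**: on `T²`, for a smooth force `f`,
`ν ≥ 0`, energy `≤ E` and any resolution, `(ν‖∇U‖²)² ≤ ν · E · ‖Δf‖₂ · √E`. [cite: AlexakisDoering2006PLA] -/
theorem planar_loudness_sq_le_of_energy_le {ν E : ℝ} (hν : 0 ≤ ν) {N : ℕ}
    {f U : UnitAddTorus (Fin 2) → EuclideanSpace ℝ (Fin 2)} (hU : SteadyState ν N f U) (hf : IsSmooth f)
    (hE : ∫ x, ‖U x‖ ^ 2 ≤ E) :
    (ν * gradNormSq U) ^ 2 ≤ ν * (E * (Real.sqrt (∫ x, ‖laplacian f x‖ ^ 2) * Real.sqrt E)) := by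
  have h0 : 0 ≤ ∫ x, ‖U x‖ ^ 2 := integral_nonneg fun _ => sq_nonneg _
  have hE0 : 0 ≤ E := h0.trans hE
  have h := planar_loudness_sq_le hν hU hf
  have hmono : (∫ x, ‖U x‖ ^ 2) * (Real.sqrt (∫ x, ‖laplacian f x‖ ^ 2) * Real.sqrt (∫ x, ‖U x‖ ^ 2)) ≤
      E * (Real.sqrt (∫ x, ‖laplacian f x‖ ^ 2) * Real.sqrt E) :=
    mul_le_mul hE (mul_le_mul_of_nonneg_left (Real.sqrt_le_sqrt hE) (Real.sqrt_nonneg _)) (by positivity) hE0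
  calc (ν * gradNormSq U) ^ 2
      ≤ ν * (∫ x, ‖U x‖ ^ 2) * (Real.sqrt (∫ x, ‖laplacian f x‖ ^ 2) * Real.sqrt (∫ x, ‖U x‖ ^ 2)) := h
    _ = ν * ((∫ x, ‖U x‖ ^ 2) * (Real.sqrt (∫ x, ‖laplacian f x‖ ^ 2) * Real.sqrt (∫ x, ‖U x‖ ^ 2))) := by ring
    _ ≤ ν * (E * (Real.sqrt (∫ x, ‖laplacian f x‖ ^ 2) * Real.sqrt E)) := mul_le_mul_of_nonneg_left hmono hν

/-- No force on `T²` has a loud witness (the planar bound sends `ν_j‖∇U‖²` to zero at bounded energy). [folklore] -/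
theorem not_loudWitness_planar {f : UnitAddTorus (Fin 2) → EuclideanSpace ℝ (Fin 2)} (hf : IsSmooth f) :
    ¬ LoudWitness f := by
  rintro ⟨ν, E, ε, hν, hlim, hε, h⟩
  obtain ⟨N₀, U₀, -, hU₀E, -⟩ := (h 0).exists
  have hE0 : 0 ≤ E := (integral_nonneg fun _ => sq_nonneg _).trans hU₀E
  set K : ℝ := E * (Real.sqrt (∫ x, ‖laplacian f x‖ ^ 2) * Real.sqrt E) with hK
  have hK0 : 0 ≤ K := by positivity
  have hev : ∀ᶠ j in atTop, ν j < ε ^ 2 / (K + 1) := hlim.eventually (gt_mem_nhds (by positivity))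
  obtain ⟨j, hj⟩ := hev.exists
  obtain ⟨N, U, hU, hUE, hloud⟩ := (h j).exists
  have h1 : ε ^ 2 ≤ (ν j * gradNormSq U) ^ 2 := pow_le_pow_left₀ hε.le hloud 2
  have h2 : (ν j * gradNormSq U) ^ 2 ≤ ν j * K := planar_loudness_sq_le_of_energy_le (hν j).le hU hf hUE
  have h3 : ν j * (K + 1) < ε ^ 2 := (lt_div_iff₀ (by positivity)).1 hj
  have h4 : ν j * K ≤ ν j * (K + 1) := by nlinarith [hν j]
  linarith

/-- VERBATIM TRANSCRIPTION of the crux to the two-dimensional torus: every `Fin 3` of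
`MirrorVariety.GalerkinSteadyZerothLaw` replaced by `Fin 2`, nothing else touched. -/
def GalerkinSteadyZerothLaw2D : Prop :=
  ∃ f : UnitAddTorus (Fin 2) → EuclideanSpace ℝ (Fin 2), Literature.Analysis.FunctionSpaces.Torus.IsSmooth f ∧ Literature.Analysis.FunctionSpaces.Torus.IsDivFree f ∧ Literature.Analysis.FunctionSpaces.Torus.HasZeroMean f ∧ ∃ (ν : ℕ → ℝ) (E ε : ℝ), (∀ j, 0 < ν j) ∧ Filter.Tendsto ν Filter.atTop (nhds 0) ∧ 0 < ε ∧ ∀ j, ∃ᶠ N in Filter.atTop, ∃ U : UnitAddTorus (Fin 2) → EuclideanSpace ℝ (Fin 2), (Literature.Analysis.FunctionSpaces.Torus.IsSmooth U ∧ Literature.Analysis.FunctionSpaces.Torus.IsDivFree U ∧ Literature.Analysis.FunctionSpaces.Torus.HasZeroMean U ∧ (∀ k ∉ (Literature.Analysis.FunctionSpaces.Torus.freqBall N).erase (0 : Fin 2 → ℤ), UnitAddTorus.mFourierCoeff (Literature.Analysis.FunctionSpaces.EuclideanSpace.complexify ∘ U) k = 0) ∧ ∀ a : UnitAddTorus (Fin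 2) → EuclideanSpace ℝ (Fin 2), Literature.Analysis.FunctionSpaces.Torus.IsSmooth a → Literature.Analysis.FunctionSpaces.Torus.IsDivFree a → (∀ k ∉ (Literature.Analysis.FunctionSpaces.Torus.freqBall N).erase (0 : Fin 2 → ℤ), UnitAddTorus.mFourierCoeff (Literature.Analysis.FunctionSpaces.EuclideanSpace.complexify ∘ a) k = 0) → ∫ x, (inner ℝ (U x) (Literature.Analysis.FunctionSpaces.Torus.convect U a x) + ν j * inner ℝ (U x) (Literature.Analysis.FunctionSpaces.Torus.laplacian a x) + inner ℝ (f x) (a x)) = 0) ∧ ∫ x, ‖U x‖ ^ 2 ≤ E ∧ ε ≤ ν j * Literature.Analysis.FunctionSpaces.Torus.gradNormSq U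

/-- The planar transcription, unfolded with the generic vocabulary. [folklore] -/
theorem galerkinSteadyZerothLaw2D_iff :
    GalerkinSteadyZerothLaw2D ↔ ∃ f : UnitAddTorus (Fin 2) → EuclideanSpace ℝ (Fin 2),
      IsSmooth f ∧ IsDivFree f ∧ HasZeroMean f ∧ LoudWitness f := Iff.rfl

/-- **DIMENSION IS LOAD-BEARING: the two-dimensional Galerkin steady zeroth law is FALSE.** Every proof of the crux must
use a genuinely three-dimensional mechanism (vortex stretching in the enstrophy balance); every witness force must drive
genuinely three-dimensional states. (The catalogued barrier `AlexakisDoering2006_energyDissipationBound`, certified here for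
the crux's own tested Galerkin form, uniformly in the resolution.) [cite: AlexakisDoering2006PLA] -/
theorem not_galerkinSteadyZerothLaw2D : ¬ GalerkinSteadyZerothLaw2D := by
  rw [galerkinSteadyZerothLaw2D_iff]
  rintro ⟨f, hf, -, -, hW⟩
  exact not_loudWitness_planar hf hW

/-! ## §5 What a refutation must prove -/

/-- **The negation of the crux, unfolded (pure logic).** `¬ crux` says: for EVERY smooth solenoidal mean-free force, along
EVERY positive sequence `ν_j → 0` and for all `E`, `ε > 0`, some `j` has, for ALL LARGE resolutions `N`, only quiet
(`ν_j‖∇U‖² < ε`) admissible states of energy `≤ E` — a uniform-in-`N` laminarisation theorem for bounded steady Galerkin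
states under arbitrary smooth forcing (route CoherentStates' `SteadyNeg` at the Galerkin level, for all forces at once).
Nothing of the kind is known in 3-D; in 2-D it is `not_galerkinSteadyZerothLaw2D` (§4). [folklore] -/
theorem not_crux_iff :
    ¬ GalerkinSteadyZerothLaw ↔
      ∀ f : UnitAddTorus (Fin 3) → EuclideanSpace ℝ (Fin 3), IsSmooth f → IsDivFree f → HasZeroMean f →
        ∀ (ν : ℕ → ℝ) (E ε : ℝ), (∀ j, 0 < ν j) → Tendsto ν atTop (𝓝 0) → 0 < ε →
          ∃ j, ∀ᶠ N in atTop, ∀ U : UnitAddTorus (Fin 3) → EuclideanSpace ℝ (Fin 3),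
            SteadyState (ν j) N f U → ∫ x, ‖U x‖ ^ 2 ≤ E → ν j * gradNormSq U < ε := by
  rw [crux_iff]
  constructor
  · intro h f hf hdiv hmean ν E ε hν hlim hε
    by_contra hc
    refine h ⟨f, hf, hdiv, hmean, ν, E, ε, hν, hlim, hε, fun j => ?_⟩
    have hj : ¬ ∀ᶠ N in atTop, ∀ U : UnitAddTorus (Fin 3) → EuclideanSpace ℝ (Fin 3),
        SteadyState (ν j) N f U → ∫ x, ‖U x‖ ^ 2 ≤ E → ν j * gradNormSq U < ε := fun hf' => hc ⟨j, hf'⟩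
    rw [Filter.not_eventually] at hj
    refine hj.mono fun N hN => ?_
    by_contra hU
    refine hN fun U hS hE => ?_
    by_contra hlt
    exact hU ⟨U, hS, hE, not_lt.1 hlt⟩
  · rintro h ⟨f, hf, hdiv, hmean, ν, E, ε, hν, hlim, hε, hL⟩
    obtain ⟨j, hj⟩ := h f hf hdiv hmean ν E ε hν hlim hε
    obtain ⟨N, ⟨U, hS, hE, hloud⟩, hN⟩ := ((hL j).and_eventually hj).exists
    exact absurd (hN U hS hE) (not_lt.2 hloud)

/-! ## §6 Why the crux resists; what is pinned down; next attacks (for ideators / planners / the lead)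

1. LOGICAL SHAPE: `∃ f, ∃ ν_j, ∃ E ε, ∀ j, ∃ᶠ N, ∃ U`. Every finite family of `(f, ν, N)`-computations is consistent with it
   (free force, free sequence, free constants, infinitely many `N`); only a THEOREM refutes it, and by `not_crux_iff` that
   theorem is uniform-in-`N` laminarisation of bounded steady Galerkin states for EVERY smooth force along EVERY `ν_j → 0⁺`.
   This is STRONGER than the kill of the sibling crux 2987 (one force): `¬ GalerkinSteadyZerothLaw → ¬ TaylorGreenLoudGalerkinStates`
   (contrapositive of the route's glue `TaylorGreenFeedsTarget`, a prover's ten-line item). In 3-D no laminarisation theorem for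
   steady states exists in print or in the tree (grounder notes g20-4/g21-1 on the item; Doering–Foias 2002 give only the upper bound
   `ε ≲ U³/ℓ`; Cheskidov 2023 p. 4 records `εℓ/U³ ∼ Re⁻¹` on KNOWN steady branches, not a theorem about all of them). The planar
   theorem IS available and is §4 here. Route CoherentStates' `SteadyNeg` (stmt-0222, classical steady solutions) would refute the
   crux only together with `FixedViscosityTransfer` AND steady regularity (weak → classical), and is itself the open problem.
2. NO JUNK: `convect U a = D a (x)[U x] = (U·∇)a` (TorusCalculus), so the tested form is the genuine steady weak form (with
   `(a·∇)U` instead it would collapse to Stokes and the crux would be false); tests band-limited to the punctured ball are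
   mean-zero automatically; `gradNormSq` is the pointwise one but `U` is smooth; `HasZeroMean U` is redundant with band-limitation
   but harmless; `0 < ν j` is decoration (§1).
3. WHAT IS PINNED DOWN (this file, sorry-free): budget window `ε² ≤ E∫‖f‖²` (tight at each fixed `ν`, §3); resolution diagonal
   `N ≥ (ε/4π²ν_jE)^{1/2}` (§2, and the high-mode dissipation floor of the landed 2987 file applies verbatim to any force);
   the content is exactly {bounded energy} ∧ {loud} ∧ {ν → 0} with `E` uniform in `j` (§3: drop any one and the Stokes arc of a
   shear force proves the rest); the mechanism must be three-dimensional (§4).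
4. BARRIER CATALOGUE (`Literature/Barriers/AnomalousDissipation`): AlexakisDoering2006 — certified for the crux's own form (§4),
   evaded only by genuinely 3-D states; Marchioro1986 (gravest planar mode) — consistent (the Stokes arc is the whole story there);
   DrivasEyink2019 Lemma 1 — necessary signature of the `N → ∞` limits (uniform Onsager roughness), no contradiction;
   Cheskidov2023 Thm 1.3 — about force-robust absence of anomaly, does not bite an `∃ f` statement. `ledger negatives` (2859, 2979,
   2984, 13037): different statements (certificate / ensemble shapes), nothing transfers.
5. NEXT ATTACKS (cycle 2): (i) 2½-D (`x₃`-independent THREE-component states and forces on `T³`): the horizontal part is a planar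
   steady state, quiet by §4 (`(ν‖∇u_h‖²)² ≤ ν‖Δf_h‖₂E^{3/2}`); the vertical component is a steady passive scalar,
   `u_h·∇u₃ = νΔu₃ + f₃`, with loudness `ν‖∇u₃‖² = (f₃, u₃)`. This is exactly the class carrying EVERY anomaly in print
   (Brué–De Lellis 2023, BCCDS 2024, Cheskidov 2023 Thm 1.3 — all with `ν`-DEPENDENT, TIME-dependent forces; see the barrier file
   `Literature/Barriers/AnomalousDissipation/TwoDimensionalEnergyDissipation.lean`, `evasions_known`). For the crux (ONE steady smooth
   force) it is OPEN in general but CLOSED NEGATIVELY for single-shell horizontal forcing `Δf_h = −Λf_h` modulo DiPerna–Lions: then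
   `‖u_h‖_{H²} ≤ Λ‖u_h‖₂` uniformly in `ν` (CTV 2013 §2; tree `TwodBoundedEnergyZeroMomentum.Negative.steady_sobolev_bounds_of_stokesEigenforce`
   for classical 2-D states), so `u_h → u₀` in `H¹`, `u₃ ⇀ θ₀` in `L²` with `u₀·∇θ₀ = f₃` weakly, and renormalisation (`u₀ ∈ W^{1,2}`,
   DiPerna–Lions) gives `(f₃, θ₀) = ∫ u₀·∇(θ₀²/2) = 0`, i.e. `ν_j‖∇u₃‖² → 0`: NO 2½-D witness with single-shell planar forcing.
   With multi-shell `f_h` the planar states may roughen (`‖∇u_h‖₂ ≲ ν^{-1/4}` is all §4 gives) and a steady scalar anomaly is not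
   excluded — the cheapest candidate witness CLASS for provers, and the next refutation target (needs: steady 2-D states at bounded
   energy have `L²`-compact limits with `W^{1,1}` regularity? unknown); (ii) single-shell (Stokes-eigen) forces in 3-D: test with `a := ΔU + ΛU` to get `ν(∫|ΔU|² − Λ‖∇U‖²) = ∫⟪ΔU,(U·∇)U⟫`
   and look for a sign/size constraint on loud bounded states under ABC / Kolmogorov forcing; (iii) the weak-limit anatomy:
   along a witness sequence `U_j ⇀ V` in `L²` with `∫⟪f,V⟫ = lim ν_j‖∇U_j‖² ≥ ε > 0` — a nonzero limit field absorbing power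
   without viscosity (Duchon–Robert `D[V] = (f,V)` if `V` is a weak Euler solution): compare with stationary convex-integration
   solutions (Choffrut–Székelyhidi 2014) — consistency check, not a kill; (iv) targets: none handed over yet (`payload.targets = []`);
   when a line is picked its stubs become the `-- Targets` section here.
-/

/-! ## Targets (lead's stuck stubs): none handed over in cycle 1. -/

/-! ## NearMisses: none. -/

end Summit.AnomalousDissipation.AnomalousDissipation.Cruxes.GalerkinSteadyZerothLaw.Disproof

end
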